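import Summits.ValiantsHypothesis.ValiantsHypothesis.Theorems.GrenetZeonDualUnipotentThreeHalvesHeavyTopIndexCodim
import Summits.ValiantsHypothesis.ValiantsHypothesis.Theorems.GrenetZeonDualUnipotentThreeHalvesHeavyTopCompositionBoundFiveSeven
import Literature.LinearAlgebra.Matrix.GerstenhaberNilpotentSubspaceEqualityProof

/-!
# `GrenetZeon.DualUnipotentThreeHalves` (stmt-ValiantsHypothesis-24318), R2 heavy-top instrument —
# `ι(s+1) ≤ C(s+1,2) − 2` FROM THEOREM C ALONE; the census row `(5,7)` conditional on Thm C(7) only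

Experiment cell «val-heavytop-census» (D-0160), engine seat val-htc-eng-2 g3 (kernel-only lane).  Book-keeping theorem closing the kernel
side of lead-g2's `(5,7)` analysis: of its three inputs — Theorem C(7) (type `(7)`), the Q1 theorem (type `(6,1)`, ✓ `HeavyTopCodimOneReducible`),
and the nil-index dimension bound (✓ `HeavyTopIndexCodim`, replacing «MMS») — only Theorem C remains a HYPOTHESIS:

* `finrank_le_of_thmC (hs : 3 ≤ s) (hC)` — if every nilpotent `V ≤ M_{s+1}(ℂ)` of dimension `C(s+1,2) − 1` containing some `Z` with `Z^s ≠ 0`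
  (a regular nilpotent) is reducible [this is Thm C(s+1), taken as the hypothesis `hC`], then every irreducible nilpotent `V ≤ M_{s+1}(ℂ)` has
  `dim V ≤ C(s+1,2) − 2` (Gerstenhaber's bound and equality case ✓ `Literature…GerstenhaberNilpotentSubspace{,EqualityProof}` dispose of
  `dim = C(s+1,2)`; ✓ `exists_regular_of_irreducible_codimOne` + `hC` of `dim = C(s+1,2) − 1`);
* `iota7_of_thmC7` — the `M₇` instance: Thm C(7) ⇒ `ι(7) ≤ 19` in the hypothesis shape of ✓ `heavyTopInst_five_seven_of_iota7`;
* `heavyTopInst_five_seven_of_thmC7 : ThmC7 → HeavyTopInst 5 7` — the `(5,7)` instance row of R2, conditional on Theorem C(7) ONLY.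

Theorem C(7) («a nilpotent `V ∋ J₇` with `dim V = 20` is triangularisable or reducible») has a pencil framework (ROADMAP-codim1, lead g0/g2) and
kernel-checked residual certificates (`Cruxes/…/ThmC7Certs.lean`); its framework is NOT ported — so this file does NOT prove `HeavyTopInst 5 7`.
Honest framing: conditional instance row / calibration; nothing here proves `HeavyTopLaw`/`HeavyTopSlowLaw`, 24318, S3 or 8062; `VP ≠ VNP` is NOT
proved.  No definitions.  [this cell]
-/

noncomputable section

-- single-conjunct layout: Sub = Summit, duplicated namespace component intended
set_option linter.dupNamespace false

namespace Summit.ValiantsHypothesis.ValiantsHypothesis.Theorems.GrenetZeon.HeavyTopIotaOfThmC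

open Matrix
open Literature.LinearAlgebra.Matrix (IsStrictUpper)
open Literature.LinearAlgebra.Matrix.GerstenhaberNilpotentSubspace (finrank_le_choose_two exists_forall_mem_iff_mem_nt mem_nt)
open Summit.ValiantsHypothesis.ValiantsHypothesis.Theorems.GrenetZeon.HeavyTopIndexCodim (exists_regular_of_irreducible_codimOne)
open Summit.ValiantsHypothesis.ValiantsHypothesis.Theorems.GrenetZeon.HeavyTopCommonKernel (not_irreducible_of_common_kernel_conj)
open Summit.ValiantsHypothesis.ValiantsHypothesis.Theorems.GrenetZeon.RadicalSplit (HeavyTopInst)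
open Summit.ValiantsHypothesis.ValiantsHypothesis.Theorems.GrenetZeon.HeavyTopCompositionBound (heavyTopInst_five_seven_of_iota7)

/-- **A space of Gerstenhaber's maximal dimension is reducible** (`n ≥ 2`): it is conjugate to `𝔫_n`, so `P e₀` is a common kernel vector.
[Gerstenhaber 1958 / de Seguins Pazzis 2013, equality case (✓ Literature); this seat] -/
theorem not_irreducible_of_finrank_eq_choose_two {n : ℕ} (hn : 2 ≤ n) (V : Submodule ℂ (Matrix (Fin n) (Fin n) ℂ))
    (hV : ∀ A ∈ V, IsNilpotent A) (hdim : Module.finrank ℂ V = n.choose 2) :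
    ¬ ∀ U : Submodule ℂ (Fin n → ℂ), (∀ A ∈ V, ∀ x ∈ U, A *ᵥ x ∈ U) → U = ⊥ ∨ U = ⊤ := by
  classical
  obtain ⟨P, hP⟩ := exists_forall_mem_iff_mem_nt V hV hdim
  have h0 : 0 < n := by omega
  refine not_irreducible_of_common_kernel_conj hn V (P : Matrix (Fin n) (Fin n) ℂ) (Units.isUnit P) (Pi.single ⟨0, h0⟩ 1)
    (by intro h; have := congrFun h ⟨0, h0⟩; simp at this) ?_
  intro Z hZ
  have hmem := (hP Z).1 hZ
  rw [mem_nt] at hmem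
  have hinv : (P : Matrix (Fin n) (Fin n) ℂ)⁻¹ = ((P⁻¹ : (Matrix (Fin n) (Fin n) ℂ)ˣ) : Matrix (Fin n) (Fin n) ℂ) :=
    (Matrix.coe_units_inv P).symm
  rw [hinv]
  ext i
  rw [Matrix.mulVec, dotProduct, Pi.zero_apply]
  refine Finset.sum_eq_zero fun j _ => ?_
  by_cases hj : j = ⟨0, h0⟩
  · subst hj
    rw [hmem i ⟨0, h0⟩ (Fin.mk_le_mk.2 (Nat.zero_le _)), zero_mul]
  · rw [Pi.single_apply, if_neg hj, mul_zero]

/-- ★ **`ι(s+1) ≤ C(s+1,2) − 2` from Theorem C alone** (`s ≥ 3`).  Hypothesis `hC` = Thm C(s+1) in usable form: a nilpotent `V ≤ M_{s+1}(ℂ)` of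
dimension `C(s+1,2) − 1` containing some `Z` with `Z^s ≠ 0` has a non-trivial proper invariant subspace.  Conclusion: every irreducible
nilpotent `V` has `dim V ≤ C(s+1,2) − 2`. [this cell] -/
theorem finrank_le_of_thmC {s : ℕ} (hs : 3 ≤ s)
    (hC : ∀ V : Submodule ℂ (Matrix (Fin (s + 1)) (Fin (s + 1)) ℂ), (∀ A ∈ V, IsNilpotent A) →
      Module.finrank ℂ V = (s + 1).choose 2 - 1 → (∃ Z ∈ V, Z ^ s ≠ 0) →
      ¬ ∀ U : Submodule ℂ (Fin (s + 1) → ℂ), (∀ A ∈ V, ∀ x ∈ U, A *ᵥ x ∈ U) → U = ⊥ ∨ U = ⊤)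
    (V : Submodule ℂ (Matrix (Fin (s + 1)) (Fin (s + 1)) ℂ)) (hV : ∀ A ∈ V, IsNilpotent A)
    (hirr : ∀ U : Submodule ℂ (Fin (s + 1) → ℂ), (∀ A ∈ V, ∀ x ∈ U, A *ᵥ x ∈ U) → U = ⊥ ∨ U = ⊤) :
    Module.finrank ℂ V ≤ (s + 1).choose 2 - 2 := by
  have hG : Module.finrank ℂ V ≤ (s + 1).choose 2 := finrank_le_choose_two (s + 1) V hV
  by_contra hlt
  rcases Nat.lt_or_ge (Module.finrank ℂ V) ((s + 1).choose 2) with h | h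
  · have hdim : Module.finrank ℂ V = (s + 1).choose 2 - 1 := by omega
    exact hC V hV hdim (exists_regular_of_irreducible_codimOne hs V hV hdim hirr) hirr
  · exact not_irreducible_of_finrank_eq_choose_two (by omega) V hV (le_antisymm hG h) hirr

/-- **`M₇`: Theorem C(7) ⇒ `ι(7) ≤ 19`**, in the hypothesis shape of ✓ `heavyTopInst_five_seven_of_iota7`. [this cell] -/
theorem iota7_of_thmC7
    (hC7 : ∀ V : Submodule ℂ (Matrix (Fin 7) (Fin 7) ℂ), (∀ A ∈ V, IsNilpotent A) → Module.finrank ℂ V = 20 →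
      (∃ Z ∈ V, Z ^ 6 ≠ 0) → ¬ ∀ U : Submodule ℂ (Fin 7 → ℂ), (∀ A ∈ V, ∀ x ∈ U, A *ᵥ x ∈ U) → U = ⊥ ∨ U = ⊤) :
    ∀ V : Submodule ℂ (Matrix (Fin 7) (Fin 7) ℂ), (∀ A ∈ V, IsNilpotent A) →
      (∀ U : Submodule ℂ (Fin 7 → ℂ), (∀ A ∈ V, ∀ x ∈ U, A *ᵥ x ∈ U) → U = ⊥ ∨ U = ⊤) → Module.finrank ℂ V ≤ 19 := by
  intro V hV hirr
  have h := finrank_le_of_thmC (s := 6) (by norm_num) (fun V hV hdim hZ => hC7 V hV (by rw [hdim]; decide) hZ) V hV hirr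
  have e : (6 + 1).choose 2 - 2 = 19 := by decide
  rw [e] at h
  exact h

/-- ★ **The `(5,7)` instance row of R2, conditional on Theorem C(7) ONLY**: `ThmC7 → HeavyTopInst 5 7` (✓ `heavyTopInst_five_seven_of_iota7` ∘
`iota7_of_thmC7`).  HONEST LABEL: conditional; Thm C(7)'s framework is pencil (residual certificates kernel-checked); `HeavyTopInst 5 7` is NOT
proved here. [this cell] -/
theorem heavyTopInst_five_seven_of_thmC7
    (hC7 : ∀ V : Submodule ℂ (Matrix (Fin 7) (Fin 7) ℂ), (∀ A ∈ V, IsNilpotent A) → Module.finrank ℂ V = 20 →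
      (∃ Z ∈ V, Z ^ 6 ≠ 0) → ¬ ∀ U : Submodule ℂ (Fin 7 → ℂ), (∀ A ∈ V, ∀ x ∈ U, A *ᵥ x ∈ U) → U = ⊥ ∨ U = ⊤) :
    HeavyTopInst 5 7 :=
  heavyTopInst_five_seven_of_iota7 (iota7_of_thmC7 hC7)

end Summit.ValiantsHypothesis.ValiantsHypothesis.Theorems.GrenetZeon.HeavyTopIotaOfThmC

end
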